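import Mathlib
import HarnessLib
import Summits.RiemannHypothesis.RiemannHypothesis.Theorems.DbrWallLogTableE

/-!
# DBR column, rung B-P(P1): two-sided rational enclosures of `log p`, primes `p ≤ 509` (part F: 461 ≤ p ≤ 509)

RH-FREE elementary inequalities (LINE 1 of the label discipline): for each prime `p` in range a lemma
`log_<p>_bounds : lo < Real.log p ∧ Real.log p < hi` with 13-decimal rational `lo, hi` (widths `≤ 1e-12`),
each obtained from Mathlib's `Real.abs_log_sub_add_sum_range_le` (the logarithmic series with remainder)
applied to `log(p/N)` for a smooth neighbour `N` of `p`, plus the bounds already proved for the primes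
dividing `N`. They feed the generic anti-persistence rung certificate (`DbrWallRungKit`): the prime terms
`Λ(n)n^{-1/2}(log q' − log n)` of the two-point gap `2Ψ(s) − Ψ(2s)` at `s = (log q')/2` are bounded below
from these enclosures. Nothing here bears on the truth of RH. [folklore]
-/

set_option linter.dupNamespace false

noncomputable section

namespace Summit.RiemannHypothesis.RiemannHypothesis.Theorems.DbrWall.LogTable

/-- `6.1333980429960 < log 461 < 6.1333980429976` (from `log(459 / 461)` by 5 terms of the logarithmic series; width 1.6e-12). [folklore] -/
theorem log_461_bounds : (6.1333980429960 : ℝ) < Real.log 461 ∧ Real.log 461 < 6.1333980429976 := by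
  have hx : |(2 / 461 : ℝ)| < 1 := by rw [abs_of_pos (by norm_num)]; norm_num
  have h := Real.abs_log_sub_add_sum_range_le hx 5
  have hN : Real.log (459 : ℝ) = 3 * Real.log 3 + Real.log 17 := by
    rw [show (459 : ℝ) = 3 ^ 3 * 17 by norm_num]
    rw [Real.log_mul (by positivity) (by positivity)]
    simp only [Real.log_pow]; push_cast; ring
  have e : Real.log (1 - 2 / 461 : ℝ) = (3 * Real.log 3 + Real.log 17) - Real.log 461 := by
    rw [show (1 - 2 / 461 : ℝ) = (459 : ℝ) / 461 by norm_num, Real.log_div (by norm_num) (by norm_num), hN]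
  rw [e, abs_of_pos (by norm_num : (0:ℝ) < 2 / 461)] at h
  obtain ⟨hl, hu⟩ := abs_le.1 h
  simp only [Finset.sum_range_succ, Finset.sum_range_zero] at hl hu
  norm_num at hl hu
  have hb3 := log_three_bounds
  have hb17 := log_seventeen_bounds
  constructor <;> linarith

/-- `6.1377270540855 < log 463 < 6.1377270540872` (from `log(461 / 463)` by 5 terms of the logarithmic series; width 1.7e-12). [folklore] -/
theorem log_463_bounds : (6.1377270540855 : ℝ) < Real.log 463 ∧ Real.log 463 < 6.1377270540872 := by
  have hx : |(2 / 463 : ℝ)| < 1 := by rw [abs_of_pos (by norm_num)]; norm_num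
  have h := Real.abs_log_sub_add_sum_range_le hx 5
  have e : Real.log (1 - 2 / 463 : ℝ) = (Real.log 461) - Real.log 463 := by
    rw [show (1 - 2 / 463 : ℝ) = (461 : ℝ) / 463 by norm_num, Real.log_div (by norm_num) (by norm_num)]
  rw [e, abs_of_pos (by norm_num : (0:ℝ) < 2 / 463)] at h
  obtain ⟨hl, hu⟩ := abs_le.1 h
  simp only [Finset.sum_range_succ, Finset.sum_range_zero] at hl hu
  norm_num at hl hu
  have hb461 := log_461_bounds
  constructor <;> linarith

/-- `6.1463292576682 < log 467 < 6.1463292576695` (from `log(466 / 467)` by 5 terms of the logarithmic series; width 1.3e-12). [folklore] -/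
theorem log_467_bounds : (6.1463292576682 : ℝ) < Real.log 467 ∧ Real.log 467 < 6.1463292576695 := by
  have hx : |(1 / 467 : ℝ)| < 1 := by rw [abs_of_pos (by norm_num)]; norm_num
  have h := Real.abs_log_sub_add_sum_range_le hx 5
  have hN : Real.log (466 : ℝ) = Real.log 2 + Real.log 233 := by
    rw [show (466 : ℝ) = 2 * 233 by norm_num]
    rw [Real.log_mul (by positivity) (by positivity)]
  have e : Real.log (1 - 1 / 467 : ℝ) = (Real.log 2 + Real.log 233) - Real.log 467 := by
    rw [show (1 - 1 / 467 : ℝ) = (466 : ℝ) / 467 by norm_num, Real.log_div (by norm_num) (by norm_num), hN]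
  rw [e, abs_of_pos (by norm_num : (0:ℝ) < 1 / 467)] at h
  obtain ⟨hl, hu⟩ := abs_le.1 h
  simp only [Finset.sum_range_succ, Finset.sum_range_zero] at hl hu
  norm_num at hl hu
  have hb2 := log_two_bounds
  have hb233 := log_233_bounds
  constructor <;> linarith

/-- `6.1717005974102 < log 479 < 6.1717005974118` (from `log(477 / 479)` by 5 terms of the logarithmic series; width 1.6e-12). [folklore] -/
theorem log_479_bounds : (6.1717005974102 : ℝ) < Real.log 479 ∧ Real.log 479 < 6.1717005974118 := by
  have hx : |(2 / 479 : ℝ)| < 1 := by rw [abs_of_pos (by norm_num)]; norm_num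
  have h := Real.abs_log_sub_add_sum_range_le hx 5
  have hN : Real.log (477 : ℝ) = 2 * Real.log 3 + Real.log 53 := by
    rw [show (477 : ℝ) = 3 ^ 2 * 53 by norm_num]
    rw [Real.log_mul (by positivity) (by positivity)]
    simp only [Real.log_pow]; push_cast; ring
  have e : Real.log (1 - 2 / 479 : ℝ) = (2 * Real.log 3 + Real.log 53) - Real.log 479 := by
    rw [show (1 - 2 / 479 : ℝ) = (477 : ℝ) / 479 by norm_num, Real.log_div (by norm_num) (by norm_num), hN]
  rw [e, abs_of_pos (by norm_num : (0:ℝ) < 2 / 479)] at h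
  obtain ⟨hl, hu⟩ := abs_le.1 h
  simp only [Finset.sum_range_succ, Finset.sum_range_zero] at hl hu
  norm_num at hl hu
  have hb3 := log_three_bounds
  have hb53 := log_fiftythree_bounds
  constructor <;> linarith

/-- `6.1882641230821 < log 487 < 6.1882641230834` (from `log(485 / 487)` by 5 terms of the logarithmic series; width 1.3e-12). [folklore] -/
theorem log_487_bounds : (6.1882641230821 : ℝ) < Real.log 487 ∧ Real.log 487 < 6.1882641230834 := by
  have hx : |(2 / 487 : ℝ)| < 1 := by rw [abs_of_pos (by norm_num)]; norm_num
  have h := Real.abs_log_sub_add_sum_range_le hx 5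
  have hN : Real.log (485 : ℝ) = Real.log 5 + Real.log 97 := by
    rw [show (485 : ℝ) = 5 * 97 by norm_num]
    rw [Real.log_mul (by positivity) (by positivity)]
  have e : Real.log (1 - 2 / 487 : ℝ) = (Real.log 5 + Real.log 97) - Real.log 487 := by
    rw [show (1 - 2 / 487 : ℝ) = (485 : ℝ) / 487 by norm_num, Real.log_div (by norm_num) (by norm_num), hN]
  rw [e, abs_of_pos (by norm_num : (0:ℝ) < 2 / 487)] at h
  obtain ⟨hl, hu⟩ := abs_le.1 h
  simp only [Finset.sum_range_succ, Finset.sum_range_zero] at hl hu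
  norm_num at hl hu
  have hb5 := log_five_bounds
  have hb97 := log_ninetyseven_bounds
  constructor <;> linarith

/-- `6.1964441277938 < log 491 < 6.1964441277956` (from `log(489 / 491)` by 5 terms of the logarithmic series; width 1.8e-12). [folklore] -/
theorem log_491_bounds : (6.1964441277938 : ℝ) < Real.log 491 ∧ Real.log 491 < 6.1964441277956 := by
  have hx : |(2 / 491 : ℝ)| < 1 := by rw [abs_of_pos (by norm_num)]; norm_num
  have h := Real.abs_log_sub_add_sum_range_le hx 5
  have hN : Real.log (489 : ℝ) = Real.log 3 + Real.log 163 := by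
    rw [show (489 : ℝ) = 3 * 163 by norm_num]
    rw [Real.log_mul (by positivity) (by positivity)]
  have e : Real.log (1 - 2 / 491 : ℝ) = (Real.log 3 + Real.log 163) - Real.log 491 := by
    rw [show (1 - 2 / 491 : ℝ) = (489 : ℝ) / 491 by norm_num, Real.log_div (by norm_num) (by norm_num), hN]
  rw [e, abs_of_pos (by norm_num : (0:ℝ) < 2 / 491)] at h
  obtain ⟨hl, hu⟩ := abs_le.1 h
  simp only [Finset.sum_range_succ, Finset.sum_range_zero] at hl hu
  norm_num at hl hu
  have hb3 := log_three_bounds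
  have hb163 := log_163_bounds
  constructor <;> linarith

/-- `6.2126060957508 < log 499 < 6.2126060957523` (from `log(497 / 499)` by 5 terms of the logarithmic series; width 1.5e-12). [folklore] -/
theorem log_499_bounds : (6.2126060957508 : ℝ) < Real.log 499 ∧ Real.log 499 < 6.2126060957523 := by
  have hx : |(2 / 499 : ℝ)| < 1 := by rw [abs_of_pos (by norm_num)]; norm_num
  have h := Real.abs_log_sub_add_sum_range_le hx 5
  have hN : Real.log (497 : ℝ) = Real.log 7 + Real.log 71 := by
    rw [show (497 : ℝ) = 7 * 71 by norm_num]
    rw [Real.log_mul (by positivity) (by positivity)]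
  have e : Real.log (1 - 2 / 499 : ℝ) = (Real.log 7 + Real.log 71) - Real.log 499 := by
    rw [show (1 - 2 / 499 : ℝ) = (497 : ℝ) / 499 by norm_num, Real.log_div (by norm_num) (by norm_num), hN]
  rw [e, abs_of_pos (by norm_num : (0:ℝ) < 2 / 499)] at h
  obtain ⟨hl, hu⟩ := abs_le.1 h
  simp only [Finset.sum_range_succ, Finset.sum_range_zero] at hl hu
  norm_num at hl hu
  have hb7 := log_seven_bounds
  have hb71 := log_seventyone_bounds
  constructor <;> linarith

/-- `6.2205901700990 < log 503 < 6.2205901701009` (from `log(501 / 503)` by 5 terms of the logarithmic series; width 1.9e-12). [folklore] -/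
theorem log_503_bounds : (6.2205901700990 : ℝ) < Real.log 503 ∧ Real.log 503 < 6.2205901701009 := by
  have hx : |(2 / 503 : ℝ)| < 1 := by rw [abs_of_pos (by norm_num)]; norm_num
  have h := Real.abs_log_sub_add_sum_range_le hx 5
  have hN : Real.log (501 : ℝ) = Real.log 3 + Real.log 167 := by
    rw [show (501 : ℝ) = 3 * 167 by norm_num]
    rw [Real.log_mul (by positivity) (by positivity)]
  have e : Real.log (1 - 2 / 503 : ℝ) = (Real.log 3 + Real.log 167) - Real.log 503 := by
    rw [show (1 - 2 / 503 : ℝ) = (501 : ℝ) / 503 by norm_num, Real.log_div (by norm_num) (by norm_num), hN]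
  rw [e, abs_of_pos (by norm_num : (0:ℝ) < 2 / 503)] at h
  obtain ⟨hl, hu⟩ := abs_le.1 h
  simp only [Finset.sum_range_succ, Finset.sum_range_zero] at hl hu
  norm_num at hl hu
  have hb3 := log_three_bounds
  have hb167 := log_167_bounds
  constructor <;> linarith

/-- `6.2324480165499 < log 509 < 6.2324480165515` (from `log(507 / 509)` by 5 terms of the logarithmic series; width 1.6e-12). [folklore] -/
theorem log_509_bounds : (6.2324480165499 : ℝ) < Real.log 509 ∧ Real.log 509 < 6.2324480165515 := by
  have hx : |(2 / 509 : ℝ)| < 1 := by rw [abs_of_pos (by norm_num)]; norm_num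
  have h := Real.abs_log_sub_add_sum_range_le hx 5
  have hN : Real.log (507 : ℝ) = Real.log 3 + 2 * Real.log 13 := by
    rw [show (507 : ℝ) = 3 * 13 ^ 2 by norm_num]
    rw [Real.log_mul (by positivity) (by positivity)]
    simp only [Real.log_pow]; push_cast; ring
  have e : Real.log (1 - 2 / 509 : ℝ) = (Real.log 3 + 2 * Real.log 13) - Real.log 509 := by
    rw [show (1 - 2 / 509 : ℝ) = (507 : ℝ) / 509 by norm_num, Real.log_div (by norm_num) (by norm_num), hN]
  rw [e, abs_of_pos (by norm_num : (0:ℝ) < 2 / 509)] at h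
  obtain ⟨hl, hu⟩ := abs_le.1 h
  simp only [Finset.sum_range_succ, Finset.sum_range_zero] at hl hu
  norm_num at hl hu
  have hb3 := log_three_bounds
  have hb13 := log_thirteen_bounds
  constructor <;> linarith

end Summit.RiemannHypothesis.RiemannHypothesis.Theorems.DbrWall.LogTable
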